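import Literature.MathematicalPhysics.QuantumManyBody.BoseEinsteinCondensation
import Mathlib.MeasureTheory.Measure.Haar.InnerProductSpace
import Mathlib.MeasureTheory.Integral.Bochner.Set
import Mathlib.InformationTheory.KullbackLeibler.KLFun
import Mathlib.Analysis.Convex.Integral

/-!
# Route `BECCellInformation` — helpers for the support item `CoarseChainRule`
# (stmt-AtomisticToContinuum-13441): cell geometry and finite-alphabet entropy bookkeeping

Helper file (`--supports stmt-AtomisticToContinuum-13441`) for
`Summit.AtomisticToContinuum.BoseEinsteinCondensation.Theses.BECCellInformation.CoarseChainRule`,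
proved in `BECCellInformationCoarseChainRule.lean`.

* Geometry of the congruent half-open cells `Π_j [k_j s, (k_j+1) s)`, `k : Fin 3 → Fin M`, of side
  `s = L/M` in `ℝ³ = EuclideanSpace ℝ (Fin 3)`: measurability, volume `s³`, pairwise disjointness,
  they cover the open box `Λ_L = (0,L)³` and their union is a.e. equal to it.
* Two finite-alphabet identities/inequalities for `InformationTheory.klFun t = t log t + 1 - t`:
  the pointwise "coarse chain rule"
  `Σ_k (m/K) klFun(K A_k/m) = Σ_k m P_k klFun(A_k/(m P_k)) + Σ_k A_k log(K P_k)` (when `Σ A = m`,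
  `Σ P = 1`, `K = #alphabet`), and `Σ_k P_k (log(K P_k))⁺ ≤ Σ_k K⁻¹ klFun(K P_k) + 1`.
* Jensen's inequality for `klFun` on a set of finite positive measure (the log-sum inequality per
  cell), and its sum over a cell partition.
* The abstract assembly `lintegral_ofReal_sum_coarse_le`: from a bound on the mutual-information
  integrand and on `KL(P ‖ uniform)` to the bound on the coarse conditional entropy integrand.

References: Cover–Thomas, *Elements of Information Theory*, Thm 2.5.3 (chain rule for relative
entropy) and Thm 2.7.1 (log-sum inequality) — elementary, reproved here over Mathlib's `klFun`.
-/

noncomputable section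

namespace Summit.AtomisticToContinuum.BoseEinsteinCondensation.Theorems

open MeasureTheory Set InformationTheory
open scoped ENNReal
open Literature.MathematicalPhysics.QuantumManyBody.BoseGas

namespace CoarseChainRule

/-! ### Coordinate boxes in `ℝ³` -/

/-- A coordinate box `{y | ∀ j, y j ∈ S j}` in `EuclideanSpace ℝ (Fin 3)` is the preimage of the
product set `Π_j S j` under the coordinate map. [folklore] -/
theorem setOf_forall_mem_eq (S : Fin 3 → Set ℝ) :
    {y : Space | ∀ j, y j ∈ S j} = (WithLp.ofLp : Space → (Fin 3 → ℝ)) ⁻¹' Set.pi Set.univ S := by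
  ext y
  simp

/-- Coordinate boxes with measurable sides are measurable. [folklore] -/
theorem measurableSet_setOf_forall_mem {S : Fin 3 → Set ℝ} (hS : ∀ j, MeasurableSet (S j)) :
    MeasurableSet {y : Space | ∀ j, y j ∈ S j} := by
  rw [setOf_forall_mem_eq]
  exact (MeasurableSet.univ_pi hS).preimage (PiLp.volume_preserving_ofLp (Fin 3)).measurable

/-- The volume of a coordinate box is the product of the lengths of its sides. [folklore] -/
theorem volume_setOf_forall_mem {S : Fin 3 → Set ℝ} (hS : ∀ j, MeasurableSet (S j)) :
    volume {y : Space | ∀ j, y j ∈ S j} = ∏ j, volume (S j) := by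
  rw [setOf_forall_mem_eq, (PiLp.volume_preserving_ofLp (Fin 3)).measure_preimage
    (MeasurableSet.univ_pi hS).nullMeasurableSet, volume_pi_pi]

/-- The open box `(0,L)³` and the half-open box `[0,L)³` agree up to a Lebesgue-null set.
[folklore] -/
theorem box_ae_eq_Ico (L : ℝ) :
    box L =ᵐ[volume] {y : Space | ∀ j, y j ∈ Set.Ico 0 L} := by
  show {y : Space | ∀ j, y j ∈ Set.Ioo 0 L} =ᵐ[volume] {y : Space | ∀ j, y j ∈ Set.Ico 0 L}
  rw [setOf_forall_mem_eq, setOf_forall_mem_eq]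
  refine (PiLp.volume_preserving_ofLp (Fin 3)).quasiMeasurePreserving.preimage_ae_eq ?_
  rw [volume_pi]
  exact (Measure.pi_Ioo_ae_eq_pi_Icc (f := fun _ => (0 : ℝ)) (g := fun _ => L)).trans
    (Measure.pi_Ico_ae_eq_pi_Icc (f := fun _ => (0 : ℝ)) (g := fun _ => L)).symm

/-! ### The cells `Π_j [k_j s, (k_j + 1) s)` -/

/-- The cells are measurable. [folklore] -/
theorem measurableSet_cell (s : ℝ) {M : ℕ} (k : Fin 3 → Fin M) :
    MeasurableSet {y : Space | ∀ j, y j ∈ Set.Ico (((k j : ℕ) : ℝ) * s)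
      ((((k j : ℕ) : ℝ) + 1) * s)} :=
  measurableSet_setOf_forall_mem fun _ => measurableSet_Ico

/-- A cell of side `s ≥ 0` has volume `s³`. [folklore] -/
theorem volume_cell {s : ℝ} (hs : 0 ≤ s) {M : ℕ} (k : Fin 3 → Fin M) :
    volume {y : Space | ∀ j, y j ∈ Set.Ico (((k j : ℕ) : ℝ) * s) ((((k j : ℕ) : ℝ) + 1) * s)} =
      ENNReal.ofReal (s ^ 3) := by
  rw [volume_setOf_forall_mem fun _ => measurableSet_Ico]
  have h : ∀ j, (((k j : ℕ) : ℝ) + 1) * s - ((k j : ℕ) : ℝ) * s = s := fun j => by ring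
  simp only [Real.volume_Ico, h, Finset.prod_const, Finset.card_univ, Fintype.card_fin,
    ENNReal.ofReal_pow hs]

/-- A point of the slab `[i s, (i+1) s)` has `⌊a/s⌋ = i`. [folklore] -/
theorem floor_div_eq_of_mem_Ico {s a : ℝ} (hs : 0 < s) {i : ℕ}
    (h : a ∈ Set.Ico ((i : ℝ) * s) (((i : ℝ) + 1) * s)) : ⌊a / s⌋₊ = i := by
  have ha : 0 ≤ a := le_trans (by positivity) h.1
  rw [Nat.floor_eq_iff (div_nonneg ha hs.le)]
  exact ⟨(le_div_iff₀ hs).2 h.1, (div_lt_iff₀ hs).2 h.2⟩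

/-- Distinct cells are disjoint. [folklore] -/
theorem pairwise_disjoint_cell {s : ℝ} (hs : 0 < s) (M : ℕ) :
    Pairwise (Function.onFun Disjoint fun k : Fin 3 → Fin M =>
      {y : Space | ∀ j, y j ∈ Set.Ico (((k j : ℕ) : ℝ) * s) ((((k j : ℕ) : ℝ) + 1) * s)}) := by
  intro k k' hne
  refine Set.disjoint_left.2 fun y hy hy' => hne (funext fun j => Fin.ext ?_)
  rw [← floor_div_eq_of_mem_Ico hs (hy j), ← floor_div_eq_of_mem_Ico hs (hy' j)]

/-- Every point of the open box `(0,L)³` lies in some cell of side `L/M` (`M ≥ 1`). [folklore] -/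
theorem exists_mem_cell {L : ℝ} (hL : 0 < L) {M : ℕ} (hM : 0 < M) {y : Space} (hy : y ∈ box L) :
    ∃ k : Fin 3 → Fin M, ∀ j, y j ∈ Set.Ico (((k j : ℕ) : ℝ) * (L / M))
      ((((k j : ℕ) : ℝ) + 1) * (L / M)) := by
  have hMr : (0 : ℝ) < M := Nat.cast_pos.2 hM
  have hs : 0 < L / M := div_pos hL hMr
  have hy' : ∀ j, 0 < y j ∧ y j < L := fun j => hy j
  have hlt : ∀ j, ⌊y j / (L / M)⌋₊ < M := fun j => by
    rw [Nat.floor_lt (div_nonneg (hy' j).1.le hs.le), div_lt_iff₀ hs, mul_div_cancel₀ _ hMr.ne']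
    exact (hy' j).2
  refine ⟨fun j => ⟨_, hlt j⟩, fun j => ⟨?_, ?_⟩⟩
  · exact (le_div_iff₀ hs).1 (Nat.floor_le (div_nonneg (hy' j).1.le hs.le))
  · exact (div_lt_iff₀ hs).1 (Nat.lt_floor_add_one _)

/-- Every cell of side `L/M` lies in the half-open box `[0,L)³`. [folklore] -/
theorem cell_subset_Ico {L : ℝ} (hL : 0 ≤ L) {M : ℕ} (k : Fin 3 → Fin M) :
    {y : Space | ∀ j, y j ∈ Set.Ico (((k j : ℕ) : ℝ) * (L / M)) ((((k j : ℕ) : ℝ) + 1) * (L / M))}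
      ⊆ {y : Space | ∀ j, y j ∈ Set.Ico 0 L} := by
  intro y hy j
  have hM : 0 < M := Fin.pos (k j)
  have hMr : (0 : ℝ) < M := Nat.cast_pos.2 hM
  have hs : 0 ≤ L / M := div_nonneg hL hMr.le
  refine ⟨le_trans (by positivity) (hy j).1, (hy j).2.trans_le ?_⟩
  have hk : ((k j : ℕ) : ℝ) + 1 ≤ M := by exact_mod_cast (k j).isLt
  calc (((k j : ℕ) : ℝ) + 1) * (L / M) ≤ (M : ℝ) * (L / M) :=
        mul_le_mul_of_nonneg_right hk hs
    _ = L := mul_div_cancel₀ _ hMr.ne'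

/-- The open box is covered by the cells. [folklore] -/
theorem box_subset_iUnion_cell {L : ℝ} (hL : 0 < L) {M : ℕ} (hM : 0 < M) :
    box L ⊆ ⋃ k : Fin 3 → Fin M, {y : Space | ∀ j, y j ∈ Set.Ico (((k j : ℕ) : ℝ) * (L / M))
      ((((k j : ℕ) : ℝ) + 1) * (L / M))} :=
  fun _ hy => Set.mem_iUnion.2 (exists_mem_cell hL hM hy)

/-- The union of the cells is a.e. equal to the open box. [folklore] -/
theorem iUnion_cell_ae_eq_box {L : ℝ} (hL : 0 < L) {M : ℕ} (hM : 0 < M) :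
    (⋃ k : Fin 3 → Fin M, {y : Space | ∀ j, y j ∈ Set.Ico (((k j : ℕ) : ℝ) * (L / M))
      ((((k j : ℕ) : ℝ) + 1) * (L / M))}) =ᵐ[volume] box L := by
  have h2 := Set.iUnion_subset fun k : Fin 3 → Fin M => cell_subset_Ico hL.le k
  exact ((LE.le.eventuallyLE h2).trans_eq (box_ae_eq_Ico L).symm).antisymm
    (LE.le.eventuallyLE (box_subset_iUnion_cell hL hM))

/-! ### Finite-alphabet bookkeeping for `klFun` -/

/-- **Pointwise coarse chain rule.** For nonnegative weights `A_k` with `Σ A_k = m`, a probability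
vector `P` on a finite alphabet of size `K` with `A_k = 0` whenever `P_k = 0`:
`Σ_k (m/K) klFun(K A_k/m) = Σ_k m P_k klFun(A_k/(m P_k)) + Σ_k A_k log(K P_k)`, i.e.
`m·KL(A/m ‖ uniform) = m·KL(A/m ‖ P) + Σ_k A_k log(K P_k)` with Mathlib's junk-free `klFun`.
[cite: CoverThomas2005, Thm 2.5.3] -/
theorem sum_klFun_coarse_eq {ι : Type*} [Fintype ι] {K m : ℝ} (hK : (Fintype.card ι : ℝ) = K)
    (hKpos : 0 < K) {A P : ι → ℝ} (hA : ∀ k, 0 ≤ A k) (hP : ∀ k, 0 ≤ P k)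
    (hsumA : ∑ k, A k = m) (hsumP : ∑ k, P k = 1) (hcompat : ∀ k, P k = 0 → A k = 0) :
    ∑ k, m / K * klFun (K * A k / m) =
      ∑ k, m * P k * klFun (A k / (m * P k)) + ∑ k, A k * Real.log (K * P k) := by
  have hm : 0 ≤ m := hsumA ▸ Finset.sum_nonneg fun k _ => hA k
  rcases hm.eq_or_lt with hm0 | hmpos
  · -- `m = 0`: everything vanishes
    have hA0 : ∀ k, A k = 0 := fun k =>
      (Finset.sum_eq_zero_iff_of_nonneg fun k _ => hA k).1 (hsumA.trans hm0.symm) k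
        (Finset.mem_univ k)
    simp [hA0, ← hm0]
  have hKne : K ≠ 0 := hKpos.ne'
  have hmne : m ≠ 0 := hmpos.ne'
  have h1 : ∀ k, m / K * klFun (K * A k / m) = A k * Real.log (K * A k / m) + m / K - A k := by
    intro k
    rw [klFun_apply]
    field_simp
  have h2 : ∀ k, m * P k * klFun (A k / (m * P k)) =
      A k * Real.log (A k / (m * P k)) + m * P k - A k := by
    intro k
    rcases (hP k).eq_or_lt with hP0 | hPpos
    · rw [hcompat k hP0.symm, ← hP0]
      simp
    · rw [klFun_apply]
      field_simp
  have h3 : ∀ k, A k * Real.log (K * A k / m) =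
      A k * Real.log (A k / (m * P k)) + A k * Real.log (K * P k) := by
    intro k
    rcases (hA k).eq_or_lt with hA0 | hApos
    · simp [← hA0]
    · have hPpos : 0 < P k := (hP k).lt_of_ne fun h => hApos.ne' (hcompat k h.symm)
      rw [← mul_add, Real.log_div (by positivity) hmne, Real.log_div hApos.ne' (by positivity),
        Real.log_mul hKne hApos.ne', Real.log_mul hmne hPpos.ne', Real.log_mul hKne hPpos.ne']
      ring
  have h4 : ∀ k, m / K * klFun (K * A k / m) =
      m * P k * klFun (A k / (m * P k)) + A k * Real.log (K * P k) + (m / K - m * P k) := by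
    intro k
    rw [h1, h2, h3]
    ring
  simp only [h4, Finset.sum_add_distrib, Finset.sum_sub_distrib, Finset.sum_const,
    Finset.card_univ, nsmul_eq_mul, hK, ← Finset.mul_sum, hsumP]
  field_simp
  ring

/-- The positive part of `Σ_k P_k log(K P_k)` exceeds it by at most one:
`Σ_k P_k (log(K P_k))⁺ ≤ Σ_k K⁻¹ klFun(K P_k) + 1 = KL(P ‖ uniform) + 1` for a probability vector
`P` on an alphabet of size `K` (since `-u log u ≤ 1` on `[0,1]`). [folklore] -/
theorem sum_mul_posPart_log_le {ι : Type*} [Fintype ι] {K : ℝ}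
    (hKpos : 0 < K) {P : ι → ℝ} (hP : ∀ k, 0 ≤ P k) (hsumP : ∑ k, P k = 1) :
    ∑ k, P k * max (Real.log (K * P k)) 0 ≤ ∑ k, K⁻¹ * klFun (K * P k) + 1 := by
  have hterm : ∀ k, P k * max (Real.log (K * P k)) 0 ≤ K⁻¹ * klFun (K * P k) + P k := by
    intro k
    have hKP : 0 ≤ K * P k := mul_nonneg hKpos.le (hP k)
    have hrhs : K⁻¹ * klFun (K * P k) + P k = P k * Real.log (K * P k) + K⁻¹ := by
      rw [klFun_apply]
      field_simp
      ring
    rw [hrhs]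
    rcases le_or_gt 0 (Real.log (K * P k)) with hlog | hlog
    · rw [max_eq_left hlog]
      linarith [inv_pos.2 hKpos]
    · rw [max_eq_right hlog.le, mul_zero]
      -- `0 ≤ P log(KP) + K⁻¹` iff `-(KP) log (KP) ≤ 1`
      have h1 : (K * P k).negMulLog ≤ 1 - K * P k := Real.negMulLog_le_one_sub_self hKP
      rw [Real.negMulLog] at h1
      have h2 : P k * Real.log (K * P k) + K⁻¹ = K⁻¹ * (1 - -(K * P k) * Real.log (K * P k)) := by
        field_simp
        ring
      rw [h2]
      exact mul_nonneg (inv_nonneg.2 hKpos.le) (by nlinarith)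
  calc ∑ k, P k * max (Real.log (K * P k)) 0 ≤ ∑ k, (K⁻¹ * klFun (K * P k) + P k) :=
        Finset.sum_le_sum fun k _ => hterm k
    _ = ∑ k, K⁻¹ * klFun (K * P k) + 1 := by rw [Finset.sum_add_distrib, hsumP]

/-! ### Jensen's inequality for `klFun` on a set (the log-sum inequality per cell) -/

/-- **Jensen / log-sum inequality on a set of finite positive measure**: for `f ≥ 0` integrable on
`t` with `klFun ∘ f` integrable on `t`,
`μ(t) · klFun(⨍_t f) ≤ ∫_t klFun(f)`. [cite: CoverThomas2005, Thm 2.7.1] -/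
theorem measureReal_mul_klFun_le_setIntegral {α : Type*} [MeasurableSpace α] {μ : Measure α}
    {t : Set α} (h0 : μ t ≠ 0) (htop : μ t ≠ ⊤) {f : α → ℝ} (hf : ∀ᵐ x ∂μ.restrict t, 0 ≤ f x)
    (hfi : IntegrableOn f t μ) (hki : IntegrableOn (fun x => klFun (f x)) t μ) :
    μ.real t * klFun ((μ.real t)⁻¹ * ∫ x in t, f x ∂μ) ≤ ∫ x in t, klFun (f x) ∂μ := by
  have hJ := ConvexOn.map_set_average_le convexOn_klFun continuous_klFun.continuousOn
    isClosed_Ici h0 htop (hf.mono fun x hx => Set.mem_Ici.2 hx) hfi hki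
  rw [setAverage_eq, setAverage_eq, smul_eq_mul, smul_eq_mul] at hJ
  have hr : 0 < μ.real t := ENNReal.toReal_pos h0 htop
  calc μ.real t * klFun ((μ.real t)⁻¹ * ∫ x in t, f x ∂μ)
      ≤ μ.real t * ((μ.real t)⁻¹ * ∫ x in t, klFun (f x) ∂μ) :=
        mul_le_mul_of_nonneg_left hJ hr.le
    _ = ∫ x in t, klFun (f x) ∂μ := by rw [← mul_assoc, mul_inv_cancel₀ hr.ne', one_mul]

/-! ### Abstract assembly: from the two crux bounds to the coarse conditional entropy bound -/

/-- **Abstract coarse chain rule bound.** On a measure space, let `A_k ≥ 0` be integrable with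
`Σ_k A_k = m` a.e., `P_k = ∫ A_k` a probability vector on an alphabet of size `K`. If the mutual
information integrand `Σ_k m P_k klFun(A_k/(m P_k))` has lower integral `≤ C_A` and the relative
entropy `Σ_k K⁻¹ klFun(K P_k)` of `P` to the uniform law is `≤ B`, then the coarse conditional
entropy integrand `Σ_k (m/K) klFun(K A_k/m)` has lower integral `≤ max C_A 0 + B + 1`.
[cite: CoverThomas2005, Thm 2.5.3] -/
theorem lintegral_ofReal_sum_coarse_le {α : Type*} [MeasurableSpace α] {μ : Measure α}
    {ι : Type*} [Fintype ι] {K CA B : ℝ} (hK : (Fintype.card ι : ℝ) = K) (hKpos : 0 < K)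
    {m : α → ℝ} {A : ι → α → ℝ} {P : ι → ℝ}
    (hA0 : ∀ k Y, 0 ≤ A k Y) (hAi : ∀ k, Integrable (A k) μ) (hP : ∀ k, P k = ∫ Y, A k Y ∂μ)
    (hsumA : ∀ᵐ Y ∂μ, ∑ k, A k Y = m Y) (hsumP : ∑ k, P k = 1)
    (boundA : ∫⁻ Y, ENNReal.ofReal (∑ k, m Y * P k * klFun (A k Y / (m Y * P k))) ∂μ ≤
      ENNReal.ofReal CA)
    (hB : 0 ≤ B) (boundKL : ∑ k, K⁻¹ * klFun (K * P k) ≤ B) :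
    ∫⁻ Y, ENNReal.ofReal (∑ k, m Y / K * klFun (K * A k Y / m Y)) ∂μ ≤
      ENNReal.ofReal (max CA 0 + B + 1) := by
  have hP0 : ∀ k, 0 ≤ P k := fun k => by rw [hP k]; exact integral_nonneg (hA0 k)
  -- compatibility `P k = 0 → A k = 0`, almost everywhere
  have hcompat : ∀ᵐ Y ∂μ, ∀ k, P k = 0 → A k Y = 0 := by
    rw [ae_all_iff]
    intro k
    by_cases hk : P k = 0
    · have h := (integral_eq_zero_iff_of_nonneg (hA0 k) (hAi k)).1 ((hP k).symm.trans hk)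
      filter_upwards [h] with Y hY _ using hY
    · exact ae_of_all _ fun Y h => absurd h hk
  -- the nonnegative majorant of the signed term `Σ_k A_k log (K P_k)`
  have hBp0 : ∀ Y, 0 ≤ ∑ k, A k Y * max (Real.log (K * P k)) 0 := fun Y =>
    Finset.sum_nonneg fun k _ => mul_nonneg (hA0 k Y) (le_max_right _ _)
  have hBpi : Integrable (fun Y => ∑ k, A k Y * max (Real.log (K * P k)) 0) μ :=
    integrable_finsetSum _ fun k _ => (hAi k).mul_const _
  have hBp_int : ∫ Y, ∑ k, A k Y * max (Real.log (K * P k)) 0 ∂μ ≤ B + 1 := by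
    have h : ∫ Y, ∑ k, A k Y * max (Real.log (K * P k)) 0 ∂μ =
        ∑ k, P k * max (Real.log (K * P k)) 0 := by
      rw [integral_finsetSum _ fun k _ => (hAi k).mul_const _]
      refine Finset.sum_congr rfl fun k _ => ?_
      rw [integral_mul_const, hP k]
    rw [h]
    exact (sum_mul_posPart_log_le hKpos hP0 hsumP).trans (by linarith)
  -- the pointwise (a.e.) identity and bound
  have hpt : ∀ᵐ Y ∂μ, ENNReal.ofReal (∑ k, m Y / K * klFun (K * A k Y / m Y)) ≤
      ENNReal.ofReal (∑ k, m Y * P k * klFun (A k Y / (m Y * P k))) +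
        ENNReal.ofReal (∑ k, A k Y * max (Real.log (K * P k)) 0) := by
    filter_upwards [hsumA, hcompat] with Y hsum hcomp
    have hm0 : 0 ≤ m Y := hsum ▸ Finset.sum_nonneg fun k _ => hA0 k Y
    have hIA0 : 0 ≤ ∑ k, m Y * P k * klFun (A k Y / (m Y * P k)) :=
      Finset.sum_nonneg fun k _ => mul_nonneg (mul_nonneg hm0 (hP0 k))
        (klFun_nonneg (div_nonneg (hA0 k Y) (mul_nonneg hm0 (hP0 k))))
    rw [sum_klFun_coarse_eq hK hKpos (fun k => hA0 k Y) hP0 hsum hsumP hcomp,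
      ← ENNReal.ofReal_add hIA0 (hBp0 Y)]
    refine ENNReal.ofReal_le_ofReal (add_le_add_right (Finset.sum_le_sum fun k _ => ?_) _)
    exact mul_le_mul_of_nonneg_left (le_max_left _ _) (hA0 k Y)
  calc ∫⁻ Y, ENNReal.ofReal (∑ k, m Y / K * klFun (K * A k Y / m Y)) ∂μ
      ≤ ∫⁻ Y, (ENNReal.ofReal (∑ k, m Y * P k * klFun (A k Y / (m Y * P k))) +
          ENNReal.ofReal (∑ k, A k Y * max (Real.log (K * P k)) 0)) ∂μ := lintegral_mono_ae hpt
    _ = ∫⁻ Y, ENNReal.ofReal (∑ k, m Y * P k * klFun (A k Y / (m Y * P k))) ∂μ +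
          ∫⁻ Y, ENNReal.ofReal (∑ k, A k Y * max (Real.log (K * P k)) 0) ∂μ :=
        lintegral_add_right' _ hBpi.aestronglyMeasurable.aemeasurable.ennreal_ofReal
    _ ≤ ENNReal.ofReal CA + ENNReal.ofReal (B + 1) := by
        refine add_le_add boundA ?_
        rw [← ofReal_integral_eq_lintegral_ofReal hBpi (ae_of_all _ hBp0)]
        exact ENNReal.ofReal_le_ofReal hBp_int
    _ ≤ ENNReal.ofReal (max CA 0) + ENNReal.ofReal (B + 1) :=
        add_le_add_left (ENNReal.ofReal_le_ofReal (le_max_left _ _)) _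
    _ = ENNReal.ofReal (max CA 0 + B + 1) := by
        rw [add_assoc, ← ENNReal.ofReal_add (le_max_right _ _) (by linarith)]

/-- **Log-sum inequality over a cell partition.** For measurable pairwise disjoint sets `t_k ⊂ ℝ³`
of common volume `c/K`, and `g ≥ 0` integrable: the relative entropy of the cell masses
`P_k = ∫_{t_k} g` to the uniform law is bounded by the relative entropy density of `g` to the
uniform density `c⁻¹` integrated over the cells,
`Σ_k K⁻¹ klFun(K P_k) ≤ ∫_{⋃ t_k} c⁻¹ klFun(c g)`. [cite: CoverThomas2005, Thm 2.7.1] -/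
theorem sum_inv_mul_klFun_le_setIntegral {ι : Type*} [Fintype ι] {t : ι → Set Space}
    (ht : ∀ k, MeasurableSet (t k)) (hdisj : Pairwise (Function.onFun Disjoint t))
    {K c : ℝ} (hKpos : 0 < K) (hc : 0 < c) (hvol : ∀ k, volume.real (t k) = c / K)
    {g : Space → ℝ} (hg0 : ∀ x, 0 ≤ g x) (hgi : Integrable g)
    (hIB : IntegrableOn (fun x => c⁻¹ * klFun (c * g x)) (⋃ k, t k)) :
    ∑ k, K⁻¹ * klFun (K * ∫ x in t k, g x) ≤ ∫ x in ⋃ k, t k, c⁻¹ * klFun (c * g x) := by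
  have hvolpos : ∀ k, 0 < volume.real (t k) := fun k => by rw [hvol k]; positivity
  have h0 : ∀ k, volume (t k) ≠ 0 := fun k => (ENNReal.toReal_pos_iff.1 (hvolpos k)).1.ne'
  have htop : ∀ k, volume (t k) ≠ ⊤ := fun k => (ENNReal.toReal_pos_iff.1 (hvolpos k)).2.ne
  rw [integral_iUnion_fintype ht hdisj fun k => hIB.mono_set (Set.subset_iUnion t k)]
  refine Finset.sum_le_sum fun k _ => ?_
  have hki : IntegrableOn (fun x => klFun (c * g x)) (t k) := by
    have h1 : IntegrableOn (fun x => c * (c⁻¹ * klFun (c * g x))) (t k) :=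
      (hIB.mono_set (Set.subset_iUnion t k)).const_mul c
    refine IntegrableOn.congr_fun h1 (fun x _ => ?_) (ht k)
    show c * (c⁻¹ * klFun (c * g x)) = klFun (c * g x)
    rw [← mul_assoc, mul_inv_cancel₀ hc.ne', one_mul]
  have hJ := measureReal_mul_klFun_le_setIntegral (h0 k) (htop k)
    (ae_of_all _ fun x => mul_nonneg hc.le (hg0 x)) (hgi.integrableOn.const_mul c) hki
  rw [integral_const_mul, hvol k] at hJ
  have h1 : (c / K)⁻¹ * (c * ∫ x in t k, g x) = K * ∫ x in t k, g x := by
    field_simp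
  rw [h1] at hJ
  rw [integral_const_mul]
  calc K⁻¹ * klFun (K * ∫ x in t k, g x) = c⁻¹ * (c / K * klFun (K * ∫ x in t k, g x)) := by
        field_simp
    _ ≤ c⁻¹ * ∫ x in t k, klFun (c * g x) := mul_le_mul_of_nonneg_left hJ (inv_nonneg.2 hc.le)

end CoarseChainRule

end Summit.AtomisticToContinuum.BoseEinsteinCondensation.Theorems

end
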